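import Summits.CriticalPhenomena.PercolationContinuityZ3.Theorems.SahiBoxTP2StrongFKGIff
import Summits.CriticalPhenomena.PercolationContinuityZ3.Theorems.SahiIsingBoxTP2

/-!
# Local strong positive association suffices: on `{−1,+1}^ι`, PA of the law conditioned on every LOCAL cylinder of
# positive mass implies box-TP₂ (hence PA conditionally on every box, local or not)

Support file of the Sahi cell (`prim-sahi`, typer seat, generation 16; `--supports stmt-CriticalPhenomena-4575`).
Theorems only (no definitions, no named facts, no sorries).  Answers the referee's wording note on generation 15's
`SahiBoxTP2StrongFKGIff.lean` (R231): there, "strongly positively associated" quantifies over ALL order boxes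
`[p,q]` of `{−1,+1}^ι`, including boxes constraining infinitely many spins, and the converse `isBoxTP2_of_spa`
uses the hypothesis at the hull `[a₁, b₂]` of two boxes.  Grimmett's strong positive association (*The
Random-Cluster Model*, §2.2, Thm. 2.27, finite volume) conditions on cylinder events; in infinite volume the
measure-theoretic analogue with content is conditioning on LOCAL cylinders — finitely many spins fixed, positive
mass.  This file proves that the LOCAL hypothesis already suffices:

* `measure_Icc_mul_le_of_rays` — the two-ray inequalities at ONE pair of boxes give the box-TP₂ inequality for that
  pair (pointwise form of generation 15's `isBoxTP2_of_ray_mono`);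
* `upper_inter_Icc_mul_le_of_pa`, `upper_inter_lower_inter_Icc_mul_le_of_pa`, `cond_Icc_mono_of_pa_hull` —
  pointwise forms of the SPA engine: PA of the law conditioned on the HULL `[a₁,b₂]` alone gives
  `μ(U ∩ [a₁,b₁]) μ[a₂,b₂] ≤ μ[a₁,b₁] μ(U ∩ [a₂,b₂])`;
* `crossBox_of_local` — **the (cross) box condition on `{−1,+1}^ι` (`ι` countable) follows from its instances on
  LOCAL boxes** `[J.piecewise a (−1), J.piecewise b 1]` (faces over an exhaustion decrease to the box; continuity
  from above) — the limit half of generation 15's `crossBox_of_tendsto_local₂`, isolated;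
* **`isBoxTP2_of_spa_local`** — if `μ` conditioned on every LOCAL box of positive mass is positively associated,
  then `μ` is box-TP₂ (local hulls of local boxes are local); with generation 15's `IsBoxTP2.spa`,
  **`isBoxTP2_iff_spa_local_spinConfig`**: box-TP₂ ⟺ locally strongly PA ⟺ strongly PA on all boxes
  (`spa_of_spa_local`) — the infinite-volume, density-free Theorem 2.27 with Grimmett's finite-window conditioning.

No sorries, no new axioms.
-/

noncomputable section

namespace Summit.CriticalPhenomena.PercolationContinuityZ3.Theorems.SahiBoxTP2

open MeasureTheory Set Function Filter Topology Literature.Probability.Percolation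
open scoped ENNReal

/-! ### Pointwise forms of the generation-15 engines -/

section Pointwise

variable {Ω : Type*} [MeasurableSpace Ω] [Lattice Ω]

/-- **The two ray inequalities at the pair `[a ∧ a', b] ≤ [a', b ∨ b']` give the box-TP₂ inequality for
`[a,b], [a',b']`** (pointwise form of `isBoxTP2_of_ray_mono`). [this work] -/
theorem measure_Icc_mul_le_of_rays {μ : Measure Ω} [IsFiniteMeasure μ] (a b a' b' : Ω)
    (h1 : μ (Ici a ∩ Icc (a ⊓ a') b) * μ (Icc a' (b ⊔ b')) ≤ μ (Icc (a ⊓ a') b) * μ (Ici a ∩ Icc a' (b ⊔ b')))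
    (h2 : μ (Iic b' ∩ Icc a' (b ⊔ b')) * μ (Icc (a ⊓ a') b) ≤
      μ (Icc a' (b ⊔ b')) * μ (Iic b' ∩ Icc (a ⊓ a') b)) :
    μ (Icc a b) * μ (Icc a' b') ≤ μ (Icc (a ⊓ a') (b ⊓ b')) * μ (Icc (a ⊔ a') (b ⊔ b')) := by
  rw [Ici_inter_Icc_inf_left, Ici_inter_Icc_sup_right] at h1
  rw [Iic_inter_Icc_sup_right, Iic_inter_Icc_inf_left] at h2
  set P := μ (Icc a' (b ⊔ b')) with hP
  set Q := μ (Icc (a ⊓ a') b) with hQ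
  by_cases hP0 : P = 0
  · have : μ (Icc a' b') = 0 := measure_mono_null (Icc_subset_Icc_right le_sup_right) hP0
    rw [this, mul_zero]; exact zero_le
  by_cases hQ0 : Q = 0
  · have : μ (Icc a b) = 0 := measure_mono_null (Icc_subset_Icc_left inf_le_left) hQ0
    rw [this, zero_mul]; exact zero_le
  have hPQ0 : P * Q ≠ 0 := mul_ne_zero hP0 hQ0
  have hPQt : P * Q ≠ ∞ := ENNReal.mul_ne_top (measure_ne_top _ _) (measure_ne_top _ _)
  rw [← ENNReal.mul_le_mul_iff_left hPQ0 hPQt]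
  calc μ (Icc a b) * μ (Icc a' b') * (P * Q) = (μ (Icc a b) * P) * (μ (Icc a' b') * Q) := by ring
    _ ≤ (Q * μ (Icc (a ⊔ a') (b ⊔ b'))) * (P * μ (Icc (a ⊓ a') (b ⊓ b'))) := mul_le_mul' h1 h2
    _ = μ (Icc (a ⊓ a') (b ⊓ b')) * μ (Icc (a ⊔ a') (b ⊔ b')) * (P * Q) := by ring

/-- PA of the law conditioned on ONE box `B = [p,q]` ⟹ `μ(U ∩ B) μ(V ∩ B) ≤ μ(U ∩ V ∩ B) μ(B)` for up-sets
`U, V`. [this work] -/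
theorem upper_inter_Icc_mul_le_of_pa {μ : Measure Ω} [IsFiniteMeasure μ] (p q : Ω)
    (hPA : μ (Icc p q) ≠ 0 → IsPositivelyAssociated ((μ (Icc p q))⁻¹ • μ.restrict (Icc p q)))
    {U V : Set Ω} (hU : IsUpperSet U) (hV : IsUpperSet V) (hUm : MeasurableSet U) (hVm : MeasurableSet V) :
    μ (U ∩ Icc p q) * μ (V ∩ Icc p q) ≤ μ (U ∩ V ∩ Icc p q) * μ (Icc p q) := by
  set B := Icc p q with hB
  by_cases hM0 : μ B = 0
  · rw [measure_inter_null_of_null_right U hM0, zero_mul]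
    exact zero_le
  have hMt : μ B ≠ ∞ := measure_ne_top _ _
  have hνapp : ∀ {S : Set Ω}, MeasurableSet S → ((μ B)⁻¹ • μ.restrict B) S = (μ B)⁻¹ * μ (S ∩ B) := fun hS => by
    rw [Measure.smul_apply, smul_eq_mul, Measure.restrict_apply hS]
  have key := (hPA hM0).mul_le_inter hU hV hUm hVm
  rw [hνapp hUm, hνapp hVm, hνapp (hUm.inter hVm)] at key
  exact mul_le_mul_of_inv_smul hM0 hMt key

/-- PA of the law conditioned on ONE box `B` ⟹ `μ(U ∩ D ∩ B) μ(B) ≤ μ(U ∩ B) μ(D ∩ B)` for `U` upper, `D` lower.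
[this work] -/
theorem upper_inter_lower_inter_Icc_mul_le_of_pa {μ : Measure Ω} [IsFiniteMeasure μ] (p q : Ω)
    (hPA : μ (Icc p q) ≠ 0 → IsPositivelyAssociated ((μ (Icc p q))⁻¹ • μ.restrict (Icc p q)))
    {U D : Set Ω} (hU : IsUpperSet U) (hD : IsLowerSet D) (hUm : MeasurableSet U) (hDm : MeasurableSet D) :
    μ (U ∩ D ∩ Icc p q) * μ (Icc p q) ≤ μ (U ∩ Icc p q) * μ (D ∩ Icc p q) := by
  set B := Icc p q with hB
  by_cases hM0 : μ B = 0
  · rw [hM0, mul_zero]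
    exact zero_le
  have hMt : μ B ≠ ∞ := measure_ne_top _ _
  have hνapp : ∀ {S : Set Ω}, MeasurableSet S → ((μ B)⁻¹ • μ.restrict B) S = (μ B)⁻¹ * μ (S ∩ B) := fun hS => by
    rw [Measure.smul_apply, smul_eq_mul, Measure.restrict_apply hS]
  haveI : IsProbabilityMeasure ((μ B)⁻¹ • μ.restrict B) := ⟨by
    rw [hνapp MeasurableSet.univ, univ_inter, ENNReal.inv_mul_cancel hM0 hMt]⟩
  have key := (hPA hM0).upperSet_lowerSet hU hD hUm hDm
  rw [hνapp hUm, hνapp hDm, hνapp (hUm.inter hDm)] at key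
  exact mul_le_mul_of_inv_smul' hM0 hMt key

/-- **PA of the law conditioned on the HULL `[a₁,b₂]` alone gives monotonicity for the pair
`[a₁,b₁] ≤ [a₂,b₂]`**: `μ(U ∩ [a₁,b₁]) μ[a₂,b₂] ≤ μ[a₁,b₁] μ(U ∩ [a₂,b₂])`. [this work] -/
theorem cond_Icc_mono_of_pa_hull (hIci : ∀ a : Ω, MeasurableSet (Ici a)) (hIic : ∀ b : Ω, MeasurableSet (Iic b))
    {μ : Measure Ω} [IsFiniteMeasure μ] {a₁ b₁ a₂ b₂ : Ω} (ha : a₁ ≤ a₂) (hb : b₁ ≤ b₂)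
    (hPA : μ (Icc a₁ b₂) ≠ 0 → IsPositivelyAssociated ((μ (Icc a₁ b₂))⁻¹ • μ.restrict (Icc a₁ b₂)))
    {U : Set Ω} (hU : IsUpperSet U) (hUm : MeasurableSet U) :
    μ (U ∩ Icc a₁ b₁) * μ (Icc a₂ b₂) ≤ μ (Icc a₁ b₁) * μ (U ∩ Icc a₂ b₂) := by
  have e1 : Icc a₁ b₁ = Iic b₁ ∩ Icc a₁ b₂ := Set.ext fun x =>
    ⟨fun hx => ⟨hx.2, hx.1, hx.2.trans hb⟩, fun hx => ⟨hx.2.1, hx.1⟩⟩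
  have e2 : Icc a₂ b₂ = Ici a₂ ∩ Icc a₁ b₂ := Set.ext fun x =>
    ⟨fun hx => ⟨hx.1, ha.trans hx.1, hx.2⟩, fun hx => ⟨hx.1, hx.2.2⟩⟩
  have top := upper_inter_Icc_mul_le_of_pa a₁ b₂ hPA hU (isUpperSet_Ici a₂) hUm (hIci a₂)
  have bot := upper_inter_lower_inter_Icc_mul_le_of_pa a₁ b₂ hPA hU (isLowerSet_Iic b₁) hUm (hIic b₁)
  rw [inter_assoc, ← e2] at top
  rw [inter_assoc, ← e1] at bot
  by_cases hM0 : μ (Icc a₁ b₂) = 0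
  · have : μ (Icc a₂ b₂) = 0 := measure_mono_null (by rw [e2]; exact inter_subset_right) hM0
    rw [this, mul_zero]
    exact zero_le
  have hMt : μ (Icc a₁ b₂) ≠ ∞ := measure_ne_top _ _
  rw [← ENNReal.mul_le_mul_iff_left hM0 hMt]
  calc μ (U ∩ Icc a₁ b₁) * μ (Icc a₂ b₂) * μ (Icc a₁ b₂)
      = μ (U ∩ Icc a₁ b₁) * μ (Icc a₁ b₂) * μ (Icc a₂ b₂) := by ring
    _ ≤ μ (U ∩ Icc a₁ b₂) * μ (Icc a₁ b₁) * μ (Icc a₂ b₂) := by gcongr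
    _ = μ (Icc a₁ b₁) * (μ (U ∩ Icc a₁ b₂) * μ (Icc a₂ b₂)) := by ring
    _ ≤ μ (Icc a₁ b₁) * (μ (U ∩ Icc a₂ b₂) * μ (Icc a₁ b₂)) := by gcongr
    _ = μ (Icc a₁ b₁) * μ (U ∩ Icc a₂ b₂) * μ (Icc a₁ b₂) := by ring

/-- **PA of the law conditioned on the local hull gives the box-TP₂ inequality for one pair of boxes**: if `μ`
conditioned on `[a ∧ a', b ∨ b']` is positively associated (or that box is null), then
`μ[a,b] μ[a',b'] ≤ μ[a ∧ a', b ∧ b'] μ[a ∨ a', b ∨ b']`. [this work] -/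
theorem measure_Icc_mul_le_of_pa_hull (hIci : ∀ a : Ω, MeasurableSet (Ici a))
    (hIic : ∀ b : Ω, MeasurableSet (Iic b)) {μ : Measure Ω} [IsFiniteMeasure μ] (a b a' b' : Ω)
    (hPA : μ (Icc (a ⊓ a') (b ⊔ b')) ≠ 0 →
      IsPositivelyAssociated ((μ (Icc (a ⊓ a') (b ⊔ b')))⁻¹ • μ.restrict (Icc (a ⊓ a') (b ⊔ b')))) :
    μ (Icc a b) * μ (Icc a' b') ≤ μ (Icc (a ⊓ a') (b ⊓ b')) * μ (Icc (a ⊔ a') (b ⊔ b')) := by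
  refine measure_Icc_mul_le_of_rays a b a' b'
    (cond_Icc_mono_of_pa_hull hIci hIic inf_le_right le_sup_left hPA (isUpperSet_Ici a) (hIci a)) ?_
  exact lowerSet_mono_of_upperSet_mono
    (fun U hU hUm => cond_Icc_mono_of_pa_hull hIci hIic inf_le_right le_sup_left hPA hU hUm)
    (isLowerSet_Iic b') (hIic b')

end Pointwise

/-! ### From local boxes to all boxes on `{−1,+1}^ι` -/

section Local

variable {ι : Type*} [Countable ι]

/-- **The cross box condition follows from its instances on LOCAL boxes** (`{−1,+1}^ι`, `ι` countable, finite
measures): if `μ[J.a,J.b] ν[J.a',J.b'] ≤ μ[J.(a ∧ a'),J.(b ∧ b')] ν[J.(a ∨ a'),J.(b ∨ b')]` for all finite windows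
`J` and all `a, b, a', b'`, where `[J.p,J.q] = [J.piecewise p (−1), J.piecewise q 1]` constrains only the spins in
`J`, then the condition holds for all boxes (faces over an exhaustion decrease to the box). [this work] -/
theorem crossBox_of_local [DecidableEq ι] (μ ν : Measure (ι → ℤˣ)) [IsFiniteMeasure μ] [IsFiniteMeasure ν]
    (hloc : ∀ (J : Finset ι) (a b a' b' : ι → ℤˣ),
      μ (Icc (J.piecewise a (-1)) (J.piecewise b 1)) * ν (Icc (J.piecewise a' (-1)) (J.piecewise b' 1)) ≤
        μ (Icc (J.piecewise (a ⊓ a') (-1)) (J.piecewise (b ⊓ b') 1)) *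
          ν (Icc (J.piecewise (a ⊔ a') (-1)) (J.piecewise (b ⊔ b') 1)))
    (a b a' b' : ι → ℤˣ) :
    μ (Icc a b) * ν (Icc a' b') ≤ μ (Icc (a ⊓ a') (b ⊓ b')) * ν (Icc (a ⊔ a') (b ⊔ b')) := by
  obtain ⟨J, hJm, hJ⟩ := exists_finset_exhaustion (ι := ι)
  set F : ℕ → (ι → ℤˣ) → (ι → ℤˣ) → Set (ι → ℤˣ) :=
    fun m p q => Icc ((J m).piecewise p (-1)) ((J m).piecewise q 1) with hF
  have hFm : ∀ m p q, MeasurableSet (F m p q) := fun m p q => measurableSet_Icc_spinConfig _ _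
  have hlim : ∀ (ρ : Measure (ι → ℤˣ)) [IsFiniteMeasure ρ] (p q : ι → ℤˣ),
      Tendsto (fun m => ρ (F m p q)) atTop (𝓝 (ρ (Icc p q))) := by
    intro ρ _ p q
    have h := tendsto_measure_iInter_atTop (μ := ρ) (fun m => (hFm m p q).nullMeasurableSet)
      (antitone_Icc_piecewise hJm p q) ⟨0, measure_ne_top _ _⟩
    rw [iInter_Icc_piecewise hJ p q] at h
    exact h
  exact le_of_tendsto_of_tendsto'
    (ENNReal.Tendsto.mul (hlim μ a b) (Or.inr (measure_ne_top _ _)) (hlim ν a' b') (Or.inr (measure_ne_top _ _)))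
    (ENNReal.Tendsto.mul (hlim μ (a ⊓ a') (b ⊓ b')) (Or.inr (measure_ne_top _ _)) (hlim ν (a ⊔ a') (b ⊔ b'))
      (Or.inr (measure_ne_top _ _))) fun m => hloc (J m) a b a' b'

/-- **Box-TP₂ follows from the box-TP₂ inequality on LOCAL boxes.** [this work] -/
theorem isBoxTP2_of_local [DecidableEq ι] (μ : Measure (ι → ℤˣ)) [IsFiniteMeasure μ]
    (hloc : ∀ (J : Finset ι) (a b a' b' : ι → ℤˣ),
      μ (Icc (J.piecewise a (-1)) (J.piecewise b 1)) * μ (Icc (J.piecewise a' (-1)) (J.piecewise b' 1)) ≤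
        μ (Icc (J.piecewise (a ⊓ a') (-1)) (J.piecewise (b ⊓ b') 1)) *
          μ (Icc (J.piecewise (a ⊔ a') (-1)) (J.piecewise (b ⊔ b') 1))) :
    IsBoxTP2 μ := fun a b a' b' => crossBox_of_local μ μ hloc a b a' b'

/-- **LOCAL STRONG POSITIVE ASSOCIATION ⟹ BOX-TP₂** (`{−1,+1}^ι`, `ι` countable, finite `μ`): if `μ` conditioned on
every LOCAL box `[J.piecewise p (−1), J.piecewise q 1]` (finitely many spins constrained) of positive mass is
positively associated, then `μ` is box-TP₂. [this work] -/
theorem isBoxTP2_of_spa_local [DecidableEq ι] (μ : Measure (ι → ℤˣ)) [IsFiniteMeasure μ]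
    (hSPA : ∀ (J : Finset ι) (p q : ι → ℤˣ), μ (Icc (J.piecewise p (-1)) (J.piecewise q 1)) ≠ 0 →
      IsPositivelyAssociated ((μ (Icc (J.piecewise p (-1)) (J.piecewise q 1)))⁻¹ •
        μ.restrict (Icc (J.piecewise p (-1)) (J.piecewise q 1)))) :
    IsBoxTP2 μ := by
  refine isBoxTP2_of_local μ fun J a b a' b' => ?_
  have key := measure_Icc_mul_le_of_pa_hull measurableSet_Ici_spinConfig measurableSet_Iic_spinConfig (μ := μ)
    (J.piecewise a (-1)) (J.piecewise b 1) (J.piecewise a' (-1)) (J.piecewise b' 1)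
  have hS := hSPA J (a ⊓ a') (b ⊔ b')
  simp only [piecewise_inf, piecewise_sup] at hS ⊢
  exact key hS

omit [Countable ι] in
/-- Strongly PA on all boxes ⟹ locally strongly PA (trivial direction). [this work] -/
theorem spa_local_of_spa [DecidableEq ι] (μ : Measure (ι → ℤˣ))
    (hSPA : ∀ p q : ι → ℤˣ, μ (Icc p q) ≠ 0 → IsPositivelyAssociated ((μ (Icc p q))⁻¹ • μ.restrict (Icc p q)))
    (J : Finset ι) (p q : ι → ℤˣ) (h0 : μ (Icc (J.piecewise p (-1)) (J.piecewise q 1)) ≠ 0) :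
    IsPositivelyAssociated ((μ (Icc (J.piecewise p (-1)) (J.piecewise q 1)))⁻¹ •
      μ.restrict (Icc (J.piecewise p (-1)) (J.piecewise q 1))) :=
  hSPA _ _ h0

/-- **`{−1,+1}^ι` (`ι` countably infinite): box-TP₂ ⟺ LOCALLY strongly positively associated** — Grimmett's
Theorem 2.27 with finite-window conditioning, density-free, infinite volume, no positivity. [this work] -/
theorem isBoxTP2_iff_spa_local_spinConfig [DecidableEq ι] [Infinite ι] (μ : Measure (ι → ℤˣ)) [IsFiniteMeasure μ] :
    IsBoxTP2 μ ↔ ∀ (J : Finset ι) (p q : ι → ℤˣ), μ (Icc (J.piecewise p (-1)) (J.piecewise q 1)) ≠ 0 →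
      IsPositivelyAssociated ((μ (Icc (J.piecewise p (-1)) (J.piecewise q 1)))⁻¹ •
        μ.restrict (Icc (J.piecewise p (-1)) (J.piecewise q 1))) :=
  ⟨fun hμ _ _ _ h0 => (isBoxTP2_iff_spa_spinConfig μ).1 hμ _ _ h0, isBoxTP2_of_spa_local μ⟩

/-- **Locally strongly PA ⟹ strongly PA on ALL boxes** (boxes constraining infinitely many spins included).
[this work] -/
theorem spa_of_spa_local [DecidableEq ι] [Infinite ι] (μ : Measure (ι → ℤˣ)) [IsFiniteMeasure μ]
    (hSPA : ∀ (J : Finset ι) (p q : ι → ℤˣ), μ (Icc (J.piecewise p (-1)) (J.piecewise q 1)) ≠ 0 →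
      IsPositivelyAssociated ((μ (Icc (J.piecewise p (-1)) (J.piecewise q 1)))⁻¹ •
        μ.restrict (Icc (J.piecewise p (-1)) (J.piecewise q 1))))
    (p q : ι → ℤˣ) (h0 : μ (Icc p q) ≠ 0) : IsPositivelyAssociated ((μ (Icc p q))⁻¹ • μ.restrict (Icc p q)) :=
  (isBoxTP2_iff_spa_spinConfig μ).1 (isBoxTP2_of_spa_local μ hSPA) p q h0

end Local

end Summit.CriticalPhenomena.PercolationContinuityZ3.Theorems.SahiBoxTP2
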